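import Summits.BirchSwinnertonDyer.BirchSwinnertonDyer.Theorems.KimAtThreeDeepUpperValueRowPow
import HarnessLib

/-!
# The per-level VALUE ROWS from `ZetaBody` with the combined certificate of valuation `α` — the good
# ANOMALOUS prime of the level (cell `bsd-addord`, seat w2-c3 gen 6; route W2 `KimAtThreeKolyvagin`, crux 19076
# `DeepUpperAtThree`, child 19562 — its good anomalous rows at `3`: `a₃ ∈ {−2, 1}`, `α = v₃(#Ẽ(𝔽₃)) = 1`)

HONEST FRAMING: END-TYPE TOOL theorem with displayed hypotheses (no definition, no named fact, no instance, no
`sorry`); Kato's fact `ZetaBody` enters as the displayed HYPOTHESIS `hbody` (never obtained); nothing about any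
curve is asserted; nothing booked; BSD is not proved by any of this.

## What

★★ `valueRow_of_zetaBody_pow` — this seat's `valueRow_of_zetaBody_general` (the `p`-Euler factor of Kato's
depleted `L`-value absorbed into the twist) with the combined certificate `v_p(uκ·∏_{q∣pA}E_q(1)) = 0`
REPLACED by `= α`; conclusion: the value row `∃ s u ψ, hval(s) ∧ s̄ = u · p^t · (p^α · δ̃_n)`.  Proof = the
general one with the companion's `sum_coeff_twist_ne_zero_and_padicValRat_eq`, `exists_units_sum_coeff_eq_pow_mul`
and ★★ `exists_valueRow_of_mem_map_span_pow` at the augmentation step.  At a good anomalous `3` (`v₃(uκ) = 1`,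
`E₃(1) = #Ẽ(𝔽₃)/3`, `A`-certificate a unit): `α = 1`.
References: [Kim2022StructureSelmer] Lemma 3.4, §3.4.1–§3.5, proof of Thm. 3.13; [Kato2004Asterisque] Thm. 6.6
(1), §6.2, Thm. 9.7; [MazurTateTeitelbaum1986Invent] §I.8; this seat's NOTES `## Design (gen 6)`.
-/

noncomputable section

open scoped BigOperators NumberField TensorProduct
open Finset IsDedekindDomain NumberField Field WeierstrassCurve Rat.HeightOneSpectrum MonoidAlgebra
open Literature.NumberTheory.GaloisRepresentations Literature.NumberTheory.GaloisCohomology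
open Literature.NumberTheory.EllipticCurves Literature.NumberTheory.EllipticCurves.ModularForms
open Literature.NumberTheory.EllipticCurves.Kato2004
open Literature.NumberTheory.EllipticCurves.Kato2004.EulerSystemValues
open Summit.BirchSwinnertonDyer.Rank1Residual.GaloisImage
open Summit.BirchSwinnertonDyer.Rank1Residual.GaloisImage.ValueRow
open Summit.BirchSwinnertonDyer.BirchSwinnertonDyer.Theorems.KimAtThreeDeepUpperValueRowsGeneral
open Summit.BirchSwinnertonDyer.BirchSwinnertonDyer.Theorems.KimAtThreeDeepUpperValueRowPow

-- the cell's Theorems namespace repeats the summit name by design (D-0017)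
set_option linter.dupNamespace false

namespace Summit.BirchSwinnertonDyer.BirchSwinnertonDyer.Theorems.KimAtThreeDeepUpperValueRowsAnomalous

variable {W : WeierstrassCurve ℚ} [W.IsElliptic] [W.IsGloballyMinimal] {p : ℕ} [Fact p.Prime]
  [ContinuousSMul ℤ_[p] (W.tateModule p)] [Module.Free ℤ_[p] (W.tateModule p)]
  [Module.Finite ℤ_[p] (W.tateModule p)] {N : ℕ} [NeZero N] {f : CuspForm (CongruenceSubgroup.Gamma0 N) 2}
  {ι : (m : ℕ) → (CyclotomicField m ℚ →+* ℂ)} {κ : ℝ}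
  {Λ : ∀ (k : ℕ) (r : Finset (HeightOneSpectrum (𝓞 ℚ))),
    H1 (tateRep W p) (cycSubgroup p k r) →ₗ[ℤ_[p]] ℚ_[p] ⊗[ℚ] CyclotomicField (cycLevel p k r) ℚ}
  {c d a : ℤ} {A : ℕ} [NeZero A]
  {z : ∀ (k : ℕ) (r : (cyclotomicLevelsRat p (badPlaces c d A N)).Ideals),
    H1 (tateRep W p) ((cyclotomicLevelsRat p (badPlaces c d A N)).level k r.1)}
  {x : ∀ (k : ℕ) (r : (cyclotomicLevelsRat p (badPlaces c d A N)).Ideals),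
    CyclotomicField (cycLevel p k r.1) ℚ}

set_option backward.isDefEq.respectTransparency false in
/-- **★★ THE VALUE ROW at `(j, σ, r)` FROM `ZetaBody`, combined certificate of valuation `α`** (the good
anomalous prime of the level): `valueRow_of_zetaBody_general` with `hκE : v_p(uκ·∏_{q∣pA}E_q(1)) = α`;
conclusion `s̄ = u · p^t · (p^α · δ̃_n)`.  Every other binder VERBATIM.
[cite: Kim2022StructureSelmer, §1.4.1, Lemma 3.4, §3.4.1–§3.5 and the proof of Thm. 3.13 (arXiv v3 pp. 7, 16, 26–28)]
[cite: Kato2004Asterisque, Thm. 6.6 (1) (p. 163), §6.2 (p. 161) and Thm. 9.7 (p. 189)]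
[cite: MazurTateTeitelbaum1986Invent, §I.8] -/
theorem valueRow_of_zetaBody_pow
    (hbody : ZetaBody W p f ι κ Λ c d a A z x) (hf : IsNewformOf W f) (hp2 : p ≠ 2)
    (hirr : W.HasIrreducibleModPGaloisRep p)
    -- Kato's constant in the coordinate of the bound witnesses: rational, `p`-INTEGRAL (not necessarily a unit)
    (uκ : ℚ) (huκ : (uκ : ℝ) = κ) (hκ0 : κ ≠ 0) (huκ1 : ‖(uκ : ℚ_[p])‖ ≤ 1)
    (d' : ℤ) (hcd : Int.gcd (c * d) A = 1) (hdd' : d * d' ≡ 1 [ZMOD (A : ℤ)])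
    (hAN : Nat.Coprime A N)
    (aM : ℕ → ℤ) (haM : ∀ q ∈ (p * A).primeFactors, cuspCoeff f q = aM q)
    -- the `p`-Euler factor TIMES Kato's constant is integral: `uκ·a_p/p`, `uκ·𝟙_{p∤N}/p ∈ ℤ_(p)`
    -- (additive `p`: `a_p = 0`, `p ∣ N`; good / multiplicative `p`: `p ∣ uκ`)
    (hκa : ‖((uκ * ((aM p : ℚ) / p) : ℚ) : ℚ_[p])‖ ≤ 1)
    (hκ1 : ‖((uκ * (if p ∣ N then 0 else (1 / p : ℚ)) : ℚ) : ℚ_[p])‖ ≤ 1)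
    (hE0 : ∏ q ∈ (p * A).primeFactors, (1 - (aM q : ℚ) / q + (if q ∣ N then 0 else (1 / q : ℚ))) ≠ 0)
    -- the COMBINED certificate of valuation `α`: `v_p(uκ · ∏_{q ∣ pA} E_q(1)) = α`
    (α : ℕ)
    (hκE : padicValRat p
      (uκ * ∏ q ∈ (p * A).primeFactors, (1 - (aM q : ℚ) / q + (if q ∣ N then 0 else (1 / q : ℚ)))) = α)
    (hR0 : (c : ℚ) ^ 2 * (d : ℚ) ^ 2 * ratMinusSymbol f ((a : ℚ) / A) -
        (c : ℚ) * (d : ℚ) ^ 2 * ratMinusSymbol f ((a * c : ℚ) / A) -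
        (c : ℚ) ^ 2 * (d : ℚ) * ratMinusSymbol f ((a * d' : ℚ) / A) +
        (c : ℚ) * (d : ℚ) * ratMinusSymbol f ((a * c * d' : ℚ) / A) ≠ 0)
    (hR : padicValRat p ((c : ℚ) ^ 2 * (d : ℚ) ^ 2 * ratMinusSymbol f ((a : ℚ) / A) -
        (c : ℚ) * (d : ℚ) ^ 2 * ratMinusSymbol f ((a * c : ℚ) / A) -
        (c : ℚ) ^ 2 * (d : ℚ) * ratMinusSymbol f ((a * d' : ℚ) / A) +
        (c : ℚ) * (d : ℚ) * ratMinusSymbol f ((a * c * d' : ℚ) / A)) = 0)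
    (η : (q : HeightOneSpectrum (𝓞 ℚ)) → (ZMod (Ideal.absNorm q.asIdeal))ˣ)
    (j t : ℕ) (σ : HeightOneSpectrum (𝓞 ℚ) → absoluteGaloisGroup ℚ)
    (hσI : ∀ q, σ q ∈ (adicCompletionPrime ℚ q).inertia (absoluteGaloisGroup ℚ))
    (hσχ : ∀ q, modNCyclotomicCharacter ℚ (Ideal.absNorm q.asIdeal) (σ q) = η q)
    (r : Finset (HeightOneSpectrum (𝓞 ℚ)))
    (hr : ∀ q ∈ r, q ∈ (cyclotomicLevelsRat p (badPlaces c d A N)).primes)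
    (hKol : ∀ q ∈ r, Kato.IsKolyvaginPrime W p (j + 1) ((primesEquiv q : Nat.Primes) : ℕ))
    (hη : ∀ q ∈ r, Subgroup.zpowers (η q) = ⊤) :
    ∃ (s : ℤ_[p]) (u : (ZMod (p ^ (j + 1)))ˣ)
      (ψ : (ℓ : ℕ) → (ZMod ℓ)ˣ →* Multiplicative (ZMod (p ^ (j + 1)))),
      (∀ q ∈ r, Function.Surjective (ψ (Ideal.absNorm q.asIdeal))) ∧
      (∃ l ∈ cycIntLattice p (cycLevel p 0 r),
        ((p : ℤ_[p]) ^ t) • ((1 : ℚ_[p]) ⊗ₜ[ℚ]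
          ((r.noncommProd (fun ℓ : HeightOneSpectrum (𝓞 ℚ) =>
              ∑ j ∈ Finset.range (((primesEquiv ℓ : Nat.Primes) : ℕ) - 1),
                (j : Module.End ℚ (CyclotomicField (cycLevel p 0 r) ℚ)) *
                  (sigma (cycLevel p 0 r) (modNCyclotomicCharacter ℚ (cycLevel p 0 r) (σ ℓ)) :
                    CyclotomicField (cycLevel p 0 r) ℚ →ₐ[ℚ]
                      CyclotomicField (cycLevel p 0 r) ℚ).toLinearMap ^ j)
            (ZetaValue.pairwise_commute_fieldDeriv (cycLevel p 0 r)
              (fun ℓ => modNCyclotomicCharacter ℚ (cycLevel p 0 r) (σ ℓ))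
              (fun ℓ => ((primesEquiv ℓ : Nat.Primes) : ℕ) - 1) r))
            (x 0 ⟨r, hr⟩ + sigma (cycLevel p 0 r) (-1) (x 0 ⟨r, hr⟩)))) -
          ((s : ℚ_[p]) ⊗ₜ[ℚ] (1 : CyclotomicField (cycLevel p 0 r) ℚ)) =
        ((p : ℤ_[p]) ^ (j + 1)) • (l : ℚ_[p] ⊗[ℚ] CyclotomicField (cycLevel p 0 r) ℚ)) ∧
      haveI : NeZero (∏ q ∈ r, Ideal.absNorm q.asIdeal) :=
        ⟨Finset.prod_ne_zero_iff.2 fun q _ h => q.ne_bot (Ideal.absNorm_eq_zero_iff.1 h)⟩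
      PadicInt.toZModPow (j + 1) s = (u : ZMod (p ^ (j + 1))) *
        ((p : ℕ) : ZMod (p ^ (j + 1))) ^ t *
          (((p : ℕ) : ZMod (p ^ (j + 1))) ^ α *
            kuriharaNumber f (p ^ (j + 1)) (∏ q ∈ r, Ideal.absNorm q.asIdeal) ψ) := by
  classical
  -- the level `n = n(r)` and its primes
  have hprim : ∀ q ∈ r, ¬ ((primesEquiv q : Nat.Primes) : ℕ) ∣ 2 * c.natAbs * d.natAbs * A * N ∧
      ((primesEquiv q : Nat.Primes) : ℕ) ≠ p := fun q hq =>
    (mem_primes_cyclotomicLevelsRat_badPlaces_iff p c d A N q).mp (hr q hq)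
  have hn : cycLevel p 0 r = ∏ q ∈ r, ((primesEquiv q : Nat.Primes) : ℕ) :=
    TameLevel.cycLevel_zero_eq_prod p r
  have hsq : Squarefree (cycLevel p 0 r) := TameLevel.squarefree_cycLevel_zero p r
  have hnN : (cycLevel p 0 r).Coprime N := by
    rw [hn]
    exact Nat.Coprime.prod_left fun q hq => (Nat.Prime.coprime_iff_not_dvd (primesEquiv q).2).mpr
      fun h => (hprim q hq).1 (dvd_mul_of_dvd_right h _)
  have hncd : (cycLevel p 0 r).Coprime (c.natAbs * d.natAbs) := by
    rw [hn]
    exact Nat.Coprime.prod_left fun q hq => (Nat.Prime.coprime_iff_not_dvd (primesEquiv q).2).mpr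
      fun h => (hprim q hq).1 (by
        obtain ⟨w, hw⟩ := h
        exact ⟨2 * A * N * w, by rw [show 2 * c.natAbs * d.natAbs * A * N =
          (c.natAbs * d.natAbs) * (2 * A * N) by ring, hw]; ring⟩)
  have hM : (p * A).Coprime (cycLevel p 0 r) := by
    rw [hn]
    refine Nat.Coprime.prod_right fun q hq => Nat.Coprime.mul_left ?_ ?_
    · exact (Nat.coprime_primes Fact.out (primesEquiv q).2).mpr (hprim q hq).2.symm
    · exact ((Nat.Prime.coprime_iff_not_dvd (primesEquiv q).2).mpr fun h =>
        (hprim q hq).1 (dvd_mul_of_dvd_left (dvd_mul_of_dvd_right h _) _)).symm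
  have hcdn : Int.gcd (c * d) (cycLevel p 0 r * A) = 1 := by
    rw [Int.gcd_eq_natAbs] at hcd ⊢
    rw [Int.natAbs_mul] at hcd ⊢
    have h2 : ((cycLevel p 0 r : ℤ) * (A : ℤ)).natAbs = cycLevel p 0 r * A := by
      rw [Int.natAbs_mul, Int.natAbs_natCast, Int.natAbs_natCast]
    rw [Int.natAbs_natCast] at hcd
    rw [h2]
    exact Nat.Coprime.mul_right hncd.symm hcd
  -- R-κ (b′): `uκ ≠ 0`
  have huκ0 : uκ ≠ 0 := by rintro rfl; exact hκ0 (by rw [← huκ, Rat.cast_zero])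
  -- the embedding unit, the avatar, the units mod `n`
  obtain ⟨u, hι⟩ := CharSum.exists_units_apply_zeta_eq_exp (cycLevel p 0 r) (ι (cycLevel p 0 r))
  obtain ⟨X, hxX, -⟩ :=
    GroupRingEval.exists_unique_eq_sum_coeff_smul_sigma_zeta (cycLevel p 0 r) hsq (x 0 ⟨r, hr⟩)
  have hcu : IsUnit ((c : ℤ) : ZMod (cycLevel p 0 r)) := by
    rw [ZMod.coe_int_isUnit_iff_isCoprime, Int.isCoprime_iff_gcd_eq_one, Int.gcd_eq_natAbs,
      Int.natAbs_natCast]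
    exact Nat.Coprime.coprime_dvd_right (dvd_mul_right _ _) hncd
  have hdu : IsUnit ((d : ℤ) : ZMod (cycLevel p 0 r)) := by
    rw [ZMod.coe_int_isUnit_iff_isCoprime, Int.isCoprime_iff_gcd_eq_one, Int.gcd_eq_natAbs,
      Int.natAbs_natCast]
    exact Nat.Coprime.coprime_dvd_right (dvd_mul_left _ _) hncd
  let uq : ℕ → (ZMod (cycLevel p 0 r))ˣ := fun q =>
    if h : q.Coprime (cycLevel p 0 r) then ZMod.unitOfCoprime q h else 1
  have huq : ∀ q ∈ (p * A).primeFactors,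
      ((uq q : (ZMod (cycLevel p 0 r))ˣ) : ZMod (cycLevel p 0 r)) = q := by
    intro q hq
    have h : q.Coprime (cycLevel p 0 r) := Nat.Coprime.coprime_dvd_left (Nat.dvd_of_mem_primeFactors hq) hM
    simp only [uq, dif_pos h, ZMod.coe_unitOfCoprime]
  -- Kolyvagin depth
  have hK : ∀ q ∈ r, p ^ (j + 1) ∣ ((primesEquiv q : Nat.Primes) : ℕ) - 1 := fun q hq =>
    (Nat.modEq_iff_dvd' (primesEquiv q).2.one_lt.le).mp (hKol q hq).modEq_one.symm
  -- the integral structure `Θ₀` of `θ̃_f(n)` (Stevens integrality)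
  obtain ⟨Θ₀, hΘ⟩ := exists_padicLift_modularElement f p (cycLevel p 0 r) fun b => by
    have h := hf.norm_ratPlusSymbol_div_le_one hp2 hirr hnN ((b : ZMod (cycLevel p 0 r)).val : ℤ)
    rwa [Int.cast_natCast] at h
  -- the integral lift `V` of the twist
  have hQ := hf.coeffField_eq_bot
  have hreal : ∀ m, (cuspCoeff f m).im = 0 := cuspCoeff_im_eq_zero_of_coeffField_eq_bot hQ
  have hpM : p ∈ (p * A).primeFactors := Nat.mem_primeFactors.mpr ⟨Fact.out, dvd_mul_right p A,
    mul_ne_zero (Fact.out : p.Prime).ne_zero (NeZero.ne A)⟩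
  have haq : ∀ q ∈ (p * A).primeFactors.erase p, ‖((((aM q : ℚ) / q : ℚ)) : ℚ_[p])‖ ≤ 1 := fun q hq =>
    norm_ratCast_div_le_one_of_ne p (Nat.prime_of_mem_primeFactors (Finset.mem_of_mem_erase hq))
      (Finset.ne_of_mem_erase hq) (aM q)
  have hNq : ∀ q ∈ (p * A).primeFactors.erase p,
      ‖(((if q ∣ N then 0 else (1 / q : ℚ)) : ℚ) : ℚ_[p])‖ ≤ 1 := by
    intro q hq
    by_cases hqN : q ∣ N
    · rw [if_pos hqN, Rat.cast_zero, norm_zero]; exact zero_le_one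
    · rw [if_neg hqN]
      have h := norm_ratCast_div_le_one_of_ne p (Nat.prime_of_mem_primeFactors (Finset.mem_of_mem_erase hq))
        (Finset.ne_of_mem_erase hq) 1
      rwa [Int.cast_one] at h
  have hsymb : ∀ m : ℤ, ‖((ratMinusSymbol f ((m : ℚ) / A) : ℚ) : ℚ_[p])‖ ≤ 1 := fun m =>
    norm_ratMinusSymbol_le_one f hp2 hreal (coprime_den_of_coprime hAN m)
  obtain ⟨V, hV⟩ := exists_padicLift_twist_scaled p f u uκ (p * A) N uq aM _ rfl c d a d' A hcu.unit
    hdu.unit _ rfl _ rfl hpM huκ1 hκa hκ1 haq hNq (hsymb a)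
    (by have h := hsymb (a * c); rwa [Int.cast_mul] at h)
    (by have h := hsymb (a * d'); rwa [Int.cast_mul] at h)
    (by have h := hsymb (a * c * d'); rwa [Int.cast_mul, Int.cast_mul] at h)
  obtain ⟨haug0, haugv⟩ := sum_coeff_twist_ne_zero_and_padicValRat_eq p hp2 f u uκ (p * A) N uq aM _ rfl
    c d a d' A hcu.unit hdu.unit _ rfl _ rfl huκ0 hE0 α hκE hR0 hR
  obtain ⟨w, hVw⟩ := exists_units_sum_coeff_eq_pow_mul p V _ hV haug0 α haugv
  -- PK-4b-C4b-2 (v): the derivative congruence at `b := χ_n ∘ σ`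
  have hmem := EulerFactorComparison.prod_deriv_mul_plusAvatar_sub_mem_map_span_of_zetaBody
    hbody hf hp2 hirr ⟨r, hr⟩ d' hcdn hdd' uκ huκ u hι X hxX
    (fun q => modNCyclotomicCharacter ℚ (cycLevel p 0 r) (σ q))
    (fun q _ ℓ' hℓ' hne => unitsMap_modNCyclotomicCharacter_eq_one_of_mem_inertia p σ hσI r q hℓ' hne)
    uq huq aM haM _ rfl hcu.unit hdu.unit hcu.unit_spec hdu.unit_spec _ rfl _ rfl (j + 1) hK Θ₀ hΘ V hV
  -- T-PK6-VROW ★★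
  exact exists_valueRow_of_mem_map_span_pow p f hp2 hf hirr j t σ η hσI hσχ r hη hKol (x 0 ⟨r, hr⟩) X hxX
    Θ₀ hΘ V α w hVw hmem

end Summit.BirchSwinnertonDyer.BirchSwinnertonDyer.Theorems.KimAtThreeDeepUpperValueRowsAnomalous

end
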